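import Literature.Analysis.FluidPDE.LeiZhang2017AxisymmetricCriteria
import Literature.Analysis.FluidPDE.Wei2016SwirlGradBound
import HarnessLib

/-!
# Chen–Fang–Zhang 2017: Prodi–Serrin type criteria on the swirl velocity `u^θ`, on `ω³` and on
# `u³` for the axisymmetric Navier–Stokes equations; global regularity for small critical swirl

Topic `Literature/Analysis/FluidPDE`; named facts (results in print, `def … : Prop`, D-0014) with
proved elementary corollaries, typed by the NS literature harvest (D-0081 §A4 topic (4),
axisymmetric) for the Type-II-exclusion seats (hard core `AxisymSwirlRegular`, stmt-…-1964; the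
`ScaledTopAlignment` residual `NoTypeII`).  Source: H. Chen, D. Fang, T. Zhang, *Regularity of 3D
axisymmetric Navier–Stokes equations*, Discrete Contin. Dyn. Syst. 37 (2017) 1923–1939 =
arXiv:1505.00905 — §1 (statements, numbering of the held arXiv text: Thm. 1.1, Remarks 1–3,
Thm. 1.2, Thm. 1.3, Thm. 1.4, Cor. 1.5), §3 ((3.14)), §4 (Lemmas 4.1–4.3).  Setting (§1): the
Cauchy problem on `ℝ³`, `ν = 1`, no force; axisymmetric `u = uʳe_r + u^θe_θ + u³e₃`, `r = √(x₁²+x₂²)`,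
`ω = curl u`; "axisymmetric weak solution with axisymmetric initial data `u₀ ∈ H²`, `div u₀ = 0`";
mixed norms `‖f‖_{L^{p,q}_T} = ‖‖f(t)‖_{L^q(ℝ³)}‖_{L^p(0,T)}` (TIME exponent first); conclusion of
every criterion: "`u` is smooth in `(0, T] × ℝ³`".  The printed statements are quoted verbatim in
the docstrings of the seven facts:

* `ChenFangZhang2017_weightedSwirl_regularity` — **Thm. 1.1 (1)** (`r^d u^θ ∈ L^{p,q}_T`,
  `2/p + 3/q ≤ 1 − d`, `3/(1−d) < q ≤ ∞`, `2/(1−d) ≤ p ≤ ∞`, `0 ≤ d < 1`);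
* `ChenFangZhang2017_criticalSwirlSmallNearAxis_regularity` — **Thm. 1.1 (2)** (`r^d u^θ ∈
  L^{∞,3/(1−d)}_T`, small in that norm on `{r ≤ α}`);
* `ChenFangZhang2017_smallCriticalSwirl_global` — **Thm. 1.2** (global strong solution when
  `‖r^d u₀^θ‖_{3/(1−d)} e^{𝒜} ≤ 1/(2C₀)`);
* `ChenFangZhang2017_verticalVorticity_regularity` — **Thm. 1.3** (`ω³ ∈ L^{p,q}_T`, `2/p + 3/q ≤ 2`);
* `ChenFangZhang2017_weightedAxial_regularity` / `…_criticalAxialSmallNearAxis_regularity` —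
  **Thm. 1.4 (1) / (2)** (the same for `r^d u³`);
* `ChenFangZhang2017_boundedRAxial_regularity` — **Cor. 1.5** (`r u³ ∈ L^{∞,∞}_T`; in print from
  Lei–Zhang 2011 via the bounded angular stream function; all-time form = Lei–Navas–Zhang 2016,
  Appendix Prop. 2);
* proved: **Remark 2** (`ChenFangZhang2017_weightedSwirl_regularity.of_holderSwirl`: a Hölder
  modulus `|Γ| ≤ C r^α` at the axis is the case `(d, p, q) = (1−α, ∞, ∞)` of Thm. 1.1 (1)),
  **Remark 3** (`….of_prodiSerrin_swirlVelocity`: `d = 0`), Thm. 1.4 (1) at `d = 0`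
  (`….of_prodiSerrin_axialVelocity`), and the exponent bookkeeping; definitions
  `ChenFangZhang2017.weightedSwirlVelocity d u = r^d u^θ`, `.weightedAxialVelocity d u = r^d u³`,
  `.dzAngularVelocity u₀ = ∂₃(u₀^θ/r)`, `.vorticityOverR u₀ = |ω₀|/r`,
  `.scriptA = 𝒜`.

## Rendering (a special case of the printed statements, never stronger)

Exactly the rendering of the accepted Lei–Zhang 2017 / Wei 2016 facts
(`LeiZhang2017AxisymmetricCriteria.lean`): a classical solution `(u, π)` of Navier–Stokes
(`ν = 1`, `f = 0`) on `[0, T) × ℝ³` (`IsClassicalNSSolutionOn (Ico 0 T) 1 0 u π`), Leray–Hopf from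
its datum (`IsLerayHopfOn T 1 0 (u 0) u`), the datum rapidly decaying (`HasRapidSpatialDecay (u 0)`
⊂ `H²`, with `r u₀^θ ∈ L^∞` by `HasRapidSpatialDecay.eLpNorm_swirl_lt_top`), every slice `u t`,
`t ∈ [0, T)`, axisymmetric (`IsAxisymmetric`).  Such a `u` coincides on `[0, T)` with the printed
weak / strong solution from `u 0` (weak–strong uniqueness), and the printed "`u` is smooth in
`(0, T] × ℝ³`" — obtained in §3 as "`u` can be continued beyond `T*` … thus `T* > T`" for the
`H²`-strong solution — is rendered as `HasSmoothExtensionPast 1 0 u T`, the continuation form the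
routes consume; Thm. 1.2's "global strong solution" is rendered by that continuation for every
`T > 0` (as `LeiZhang2017_smallSwirl_regularity`).  Mixed classes = the accepted guarded
`MemLqLp p q F (Ioo 0 T)` (`LerayHopf.lean`; CFZ's time-first `L^{p,q}_T` is `MemLqLp`'s argument
order), exponents in `ℝ≥0∞`, the real weight `d ∈ [0,1)` entering through `ENNReal.ofReal`;
`r^d = (cylRadius x)^d` (real power, `= 1` for `d = 0`); `u^θ = swirlVelocity` (junk `0` on the
axis, a null set), `u³ = axialVelocity`, `ω³ = (curl u) 2`, `Γ = swirl = r u^θ`.  The "sufficient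
small `ε`" of Thm. 1.1 (2) / 1.4 (2) is by the proof ((3.14): `3Cε = 1/8`, `C` from the
Sobolev–Hardy Lemma 2.1 with weight `d`) a constant depending on `d` only — rendered
`∀ d, ∃ ε > 0, ∀ solutions`; likewise Thm. 1.2's `C₀, C₁, C₂` ((4.2), Lemma 4.2, (4.6)) —
`∀ d, ∃ C₀ C₁ C₂ > 0, ∀ data` (the literal "∀ data ∃ constants" would be vacuous).  Thm. 1.2's
displayed "`‖ω₀/r‖₂`" is rendered LITERALLY as `‖ |curl u₀|/r ‖₂` (the proof uses only
`‖ω₀^θ/r‖₂ ≤ ‖ω₀/r‖₂`, so the literal reading is the weaker fact); the data norms in `𝒜` are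
real `toReal`s with finiteness asked explicitly.  Cor. 1.5 (print: suitable weak solutions, `L²`
data — a larger class) is rendered in the same classical frame with `r|u³| ≤ C` pointwise on
`[0,T) × ℝ³`.  Not restated: Lemmas 2.1–2.6, the `(Φ, Γ)` system (1.6), Remark 3's interpolated
range `u^θ/r^d ∈ L^{p,q}`, `2/p + 3/q ≤ 1 + d`.

## Mathlib / tree search

Mathlib has no Navier–Stokes theory.  `lean search 'ChenFangZhang|1505.00905'` (2026-08-26):
docstring mentions only (`AxisymQuotientEquations*`, `LeiZhang2017AxisymmetricCriteria`,
`ChenTsaiZhang2022LocalRegularity`, `Seregin2022LogSwirlCriterion`); bib key `ChenFangZhang2017`.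
Reused: `IsClassicalNSSolutionOn`, `HasSmoothExtensionPast`, `IsLerayHopfOn`, `MemLqLp`,
`eLqLpNorm`, `memLqLp_of_ae_eLpNorm_le`, `HasRapidSpatialDecay(.eLpNorm_swirl_lt_top)`,
`IsAxisymmetric`, `cylRadius`, `swirl`, `swirlVelocity`, `axialVelocity`, `curl`,
`Wei2016.measurable_swirlVelocity`.  Neighbours: `LeiZhang2017_logModulus_regularity` /
`Wei2016_logModulus_regularity` (logarithmic swirl moduli superseding Remark 2), `knss_bound_C_over_r`,
`LeiZhang2011_regularity_bmoStream_holds` (behind Cor. 1.5),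
`chaeWolf2021_oneComponent_almostSerrin_criterion` (symmetry-free `u₃`, strict inequality).

## References

* H. Chen, D. Fang, T. Zhang, Discrete Contin. Dyn. Syst. 37 (2017) 1923–1939, arXiv:1505.00905:
  §1 Thm. 1.1, Remarks 1–3, Thm. 1.2, Thm. 1.3, Thm. 1.4, Cor. 1.5; §3 (3.14); §4. [`ChenFangZhang2017`]
* Z. Lei, E. A. Navas, Q. S. Zhang, Comm. Math. Phys. 341 (2016) 289–307, arXiv:1309.6625,
  Appendix Prop. 2. [`LeiNavasZhang2016`]
* Z. Lei, Q. S. Zhang, J. Funct. Anal. 261 (2011) 2323–2345, Thm. 1.4. [`LeiZhang2011`]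
-/

noncomputable section

open MeasureTheory Set Function Filter
open _root_.Topology
open scoped NNReal ENNReal

namespace Literature.Analysis.FluidPDE

/-- Local notation for physical space `ℝ³ = EuclideanSpace ℝ (Fin 3)`. -/
local notation "ℝ³" => EuclideanSpace ℝ (Fin 3)

namespace ChenFangZhang2017

/-- The weighted swirl velocity `r^d u^θ`, `(t, x) ↦ (cylRadius x)^d · swirlVelocity (u t) x`
(Chen–Fang–Zhang 2017, Thm. 1.1; real power, `= u^θ` for `d = 0`; junk `0` on the axis). [cite: ChenFangZhang2017, Thm. 1.1] -/
def weightedSwirlVelocity (d : ℝ) (u : ℝ → ℝ³ → ℝ³) (t : ℝ) (x : ℝ³) : ℝ :=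
  cylRadius x ^ d * swirlVelocity (u t) x

/-- The weighted vertical velocity `r^d u³`, `(t, x) ↦ (cylRadius x)^d · axialVelocity (u t) x`
(Chen–Fang–Zhang 2017, Thm. 1.4: the quantity `r^d u³`). [cite: ChenFangZhang2017, Thm. 1.4] -/
def weightedAxialVelocity (d : ℝ) (u : ℝ → ℝ³ → ℝ³) (t : ℝ) (x : ℝ³) : ℝ :=
  cylRadius x ^ d * axialVelocity (u t) x

/-- `∂₃(u₀^θ/r)`, the `x₃`-derivative of the angular velocity of a datum (Chen–Fang–Zhang 2017,
Thm. 1.2, data norm `‖∂₃(u₀^θ/r)‖₂`; Fréchet-derivative junk on the axis, a null set). [cite: ChenFangZhang2017, Thm. 1.2] -/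
def dzAngularVelocity (u₀ : ℝ³ → ℝ³) (x : ℝ³) : ℝ :=
  fderiv ℝ (fun y => swirlVelocity u₀ y / cylRadius y) x (EuclideanSpace.single 2 1)

/-- `|ω₀|/r` (the LITERAL reading of the data norm "`‖ω₀/r‖₂`" of Chen–Fang–Zhang 2017, Thm. 1.2;
the proof, (4.4)–(4.6), uses `‖ω₀^θ/r‖₂ ≤ ‖ω₀/r‖₂`). Junk `0` on the axis. [cite: ChenFangZhang2017, Thm. 1.2] -/
def vorticityOverR (u₀ : ℝ³ → ℝ³) (x : ℝ³) : ℝ :=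
  ‖curl u₀ x‖ / cylRadius x

/-- The real `L²(ℝ³)` norm `‖f‖₂` (`toReal` of `eLpNorm`; junk `0` when infinite). [folklore] -/
def l2 {F : Type*} [NormedAddCommGroup F] (f : ℝ³ → F) : ℝ :=
  (eLpNorm f 2 volume).toReal

/-- The data functional `𝒜 = C₂‖u₀‖₂² (‖ω₀^θ‖₂² + C₁(‖ω₀/r‖₂ + ‖∂₃(u₀^θ/r)‖₂)^{4/3} ‖u₀‖₂²)` of
Chen–Fang–Zhang 2017, Thm. 1.2 (display after (1.7)), with `ω₀^θ = swirlVelocity (curl u₀)` and the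
literal `‖ω₀/r‖₂ = ‖vorticityOverR u₀‖₂`. [cite: ChenFangZhang2017, Thm. 1.2] -/
def scriptA (C₁ C₂ : ℝ) (u₀ : ℝ³ → ℝ³) : ℝ :=
  C₂ * l2 u₀ ^ 2 * (l2 (swirlVelocity (curl u₀)) ^ 2 +
    C₁ * (l2 (vorticityOverR u₀) + l2 (dzAngularVelocity u₀)) ^ (4 / 3 : ℝ) * l2 u₀ ^ 2)

/-- `r^d u^θ` at `d = 0` is the swirl velocity `u^θ` (the case `d = 0` of the quantity of Thm. 1.1). [cite: ChenFangZhang2017, Thm. 1.1] -/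
@[simp] theorem weightedSwirlVelocity_zero (u : ℝ → ℝ³ → ℝ³) :
    weightedSwirlVelocity 0 u = fun t x => swirlVelocity (u t) x := by
  funext t x
  simp [weightedSwirlVelocity, Real.rpow_zero]

/-- `r^d u³` at `d = 0` is the vertical velocity `u³` (the case `d = 0` of the quantity of Thm. 1.4). [cite: ChenFangZhang2017, Thm. 1.4] -/
@[simp] theorem weightedAxialVelocity_zero (u : ℝ → ℝ³ → ℝ³) :
    weightedAxialVelocity 0 u = fun t x => axialVelocity (u t) x := by
  funext t x
  simp [weightedAxialVelocity, Real.rpow_zero]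

/-- Off the axis, `r^d u^θ = r^{d-1} Γ`, `Γ = swirl = r u^θ` (Remark 2's rewriting). [cite: ChenFangZhang2017, Remark 2] -/
theorem weightedSwirlVelocity_eq_rpow_mul_swirl {d : ℝ} (u : ℝ → ℝ³ → ℝ³) (t : ℝ) {x : ℝ³}
    (hx : cylRadius x ≠ 0) :
    weightedSwirlVelocity d u t x = cylRadius x ^ (d - 1) * swirl (u t) x := by
  have hr : 0 < cylRadius x := lt_of_le_of_ne (cylRadius_nonneg x) (Ne.symm hx)
  rw [weightedSwirlVelocity, swirl_eq_cylRadius_mul_swirlVelocity (u t) hx, ← mul_assoc,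
    Real.rpow_sub_one hr.ne']
  field_simp

/-- On the axis `r^d u^θ` vanishes (junk value of `swirlVelocity`). [cite: ChenFangZhang2017, Thm. 1.1] -/
theorem weightedSwirlVelocity_eq_zero_of_cylRadius_eq_zero {d : ℝ} (u : ℝ → ℝ³ → ℝ³) (t : ℝ)
    {x : ℝ³} (hx : cylRadius x = 0) : weightedSwirlVelocity d u t x = 0 := by
  have : swirlVelocity (u t) x = 0 := by simp [swirlVelocity, eTheta, hx]
  simp [weightedSwirlVelocity, this]

/-- The weighted swirl velocity `r^d u^θ` (Thm. 1.1) of a continuous slice is measurable. [cite: ChenFangZhang2017, Thm. 1.1] -/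
theorem measurable_weightedSwirlVelocity (d : ℝ) {u : ℝ → ℝ³ → ℝ³} {t : ℝ}
    (hu : Continuous (u t)) : Measurable (weightedSwirlVelocity d u t) :=
  (continuous_cylRadius.measurable.pow_const d).mul (Wei2016.measurable_swirlVelocity hu)

end ChenFangZhang2017

open ChenFangZhang2017

/-! ### The named facts -/

/-- **Chen–Fang–Zhang 2017, Theorem 1.1 (1): Prodi–Serrin criterion on the weighted swirl
velocity `r^d u^θ`.**  "If `r^d u^θ ∈ L^{p,q}_T`, where `2/p + 3/q ≤ 1 − d`, `3/(1−d) < q ≤ ∞`,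
`2/(1−d) ≤ p ≤ ∞` [`0 ≤ d < 1`], then `u` is smooth in `(0, T] × ℝ³`" (axisymmetric solutions from
axisymmetric `H²` data, `ν = 1`).  Rendered in the continuation frame of the module docstring
(`r^d u^θ` in the guarded class `MemLqLp p q` on `(0, T)`). [cite: ChenFangZhang2017, Thm. 1.1 (1)] -/
def ChenFangZhang2017_weightedSwirl_regularity : Prop :=
  ∀ (d : ℝ) (p q : ℝ≥0∞), 0 ≤ d → d < 1 →
    2 / p + 3 / q ≤ ENNReal.ofReal (1 - d) → ENNReal.ofReal (3 / (1 - d)) < q →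
    ENNReal.ofReal (2 / (1 - d)) ≤ p →
    ∀ (T : ℝ) (u : ℝ → ℝ³ → ℝ³) (π : ℝ → ℝ³ → ℝ), 0 < T →
    IsClassicalNSSolutionOn (Ico 0 T) 1 0 u π → IsLerayHopfOn T 1 0 (u 0) u →
    HasRapidSpatialDecay (u 0) → (∀ t ∈ Ico 0 T, IsAxisymmetric (u t)) →
    MemLqLp p q (weightedSwirlVelocity d u) (Ioo 0 T) →
    HasSmoothExtensionPast 1 0 u T

/-- **Chen–Fang–Zhang 2017, Theorem 1.1 (2): the critical class `L^{∞, 3/(1−d)}` with smallness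
near the axis.**  "If `r^d u^θ ∈ L^{∞,3/(1−d)}_T`, and there exist `α > 0` and sufficient small
`ε > 0` such that `‖r^d u^θ 1_{r ≤ α}‖_{L^{∞,3/(1−d)}_T} ≤ ε`, where `0 ≤ d < 1`, then `u` is
smooth in `(0, T] × ℝ³`"; by the proof ((3.14), `3Cε = 1/8`) the threshold `ε` depends on `d`
only (`∀ d, ∃ ε, ∀ solutions`).  Rendered in the continuation frame of the module docstring, the
smallness as a bound on the accepted `eLqLpNorm` of the truncated field. [cite: ChenFangZhang2017, Thm. 1.1 (2)] -/
def ChenFangZhang2017_criticalSwirlSmallNearAxis_regularity : Prop :=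
  ∀ d : ℝ, 0 ≤ d → d < 1 → ∃ ε : ℝ, 0 < ε ∧
    ∀ (T : ℝ) (u : ℝ → ℝ³ → ℝ³) (π : ℝ → ℝ³ → ℝ), 0 < T →
    IsClassicalNSSolutionOn (Ico 0 T) 1 0 u π → IsLerayHopfOn T 1 0 (u 0) u →
    HasRapidSpatialDecay (u 0) → (∀ t ∈ Ico 0 T, IsAxisymmetric (u t)) →
    MemLqLp ∞ (ENNReal.ofReal (3 / (1 - d))) (weightedSwirlVelocity d u) (Ioo 0 T) →
    (∃ α : ℝ, 0 < α ∧
      eLqLpNorm ∞ (ENNReal.ofReal (3 / (1 - d)))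
        (fun t => {x : ℝ³ | cylRadius x ≤ α}.indicator (weightedSwirlVelocity d u t)) (Ioo 0 T) ≤
        ENNReal.ofReal ε) →
    HasSmoothExtensionPast 1 0 u T

/-- **Chen–Fang–Zhang 2017, Theorem 1.2: global regularity for small critical weighted swirl.**
"There exist positive constants `C₀`, `C₁` and `C₂`, such that if the initial angular velocity
`u₀^θ` satisfies `‖r^d u₀^θ‖_{3/(1−d)} exp(𝒜) ≤ 1/(2C₀)`, where `0 ≤ d < 1`,
`𝒜 = C₂‖u₀‖₂²(‖ω₀^θ‖₂² + C₁(‖ω₀/r‖₂ + ‖∂₃(u₀^θ/r)‖₂)^{4/3}‖u₀‖₂²)`, then the system (1.1) has a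
unique global strong solution `u ∈ C(ℝ⁺; H²) ∩ L²_loc(ℝ⁺; Ḣ³)`" (axisymmetric `H²` data, `ν = 1`;
the constants depend on `d` only, §4).  Rendered in the continuation frame of the module
docstring (as `LeiZhang2017_smallSwirl_regularity`), with the LITERAL `‖ω₀/r‖₂ = ‖|curl u₀|/r‖₂`
and the finiteness of the displayed data norms explicit. [cite: ChenFangZhang2017, Thm. 1.2] -/
def ChenFangZhang2017_smallCriticalSwirl_global : Prop :=
  ∀ d : ℝ, 0 ≤ d → d < 1 → ∃ C₀ C₁ C₂ : ℝ, 0 < C₀ ∧ 0 < C₁ ∧ 0 < C₂ ∧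
    ∀ (T : ℝ) (u : ℝ → ℝ³ → ℝ³) (π : ℝ → ℝ³ → ℝ), 0 < T →
    IsClassicalNSSolutionOn (Ico 0 T) 1 0 u π → IsLerayHopfOn T 1 0 (u 0) u →
    HasRapidSpatialDecay (u 0) → (∀ t ∈ Ico 0 T, IsAxisymmetric (u t)) →
    eLpNorm (vorticityOverR (u 0)) 2 volume < ∞ →
    eLpNorm (dzAngularVelocity (u 0)) 2 volume < ∞ →
    eLpNorm (weightedSwirlVelocity d u 0) (ENNReal.ofReal (3 / (1 - d))) volume < ∞ →
    (eLpNorm (weightedSwirlVelocity d u 0) (ENNReal.ofReal (3 / (1 - d))) volume).toReal *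
        Real.exp (scriptA C₁ C₂ (u 0)) ≤ 1 / (2 * C₀) →
    HasSmoothExtensionPast 1 0 u T

/-- **Chen–Fang–Zhang 2017, Theorem 1.3: criterion on the vertical vorticity `ω³`.**  "If
`r u₀^θ ∈ L^∞(ℝ³)` and `ω³ ∈ L^{p,q}_T`, `2/p + 3/q ≤ 2`, `3/2 < q < ∞`, `1 < p ≤ ∞`, then the weak
solution `u` is smooth in `(0, T] × ℝ³`" (axisymmetric `H²` data, `ν = 1`).  Rendered in the
continuation frame of the module docstring (`r u₀^θ ∈ L^∞` kept explicit as printed). [cite: ChenFangZhang2017, Thm. 1.3] -/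
def ChenFangZhang2017_verticalVorticity_regularity : Prop :=
  ∀ (p q : ℝ≥0∞), 2 / p + 3 / q ≤ 2 → (3 / 2 : ℝ≥0∞) < q → q < ∞ → 1 < p →
    ∀ (T : ℝ) (u : ℝ → ℝ³ → ℝ³) (π : ℝ → ℝ³ → ℝ), 0 < T →
    IsClassicalNSSolutionOn (Ico 0 T) 1 0 u π → IsLerayHopfOn T 1 0 (u 0) u →
    HasRapidSpatialDecay (u 0) → (∀ t ∈ Ico 0 T, IsAxisymmetric (u t)) →
    eLpNorm (swirl (u 0)) ∞ volume < ∞ →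
    MemLqLp p q (fun t x => curl (u t) x 2) (Ioo 0 T) →
    HasSmoothExtensionPast 1 0 u T

/-- **Chen–Fang–Zhang 2017, Theorem 1.4 (1): Prodi–Serrin criterion on the weighted vertical
velocity `r^d u³`.**  "If `r^d u³ ∈ L^{p,q}_T`, `2/p + 3/q ≤ 1 − d`, `3/(1−d) < q ≤ ∞`,
`2/(1−d) ≤ p ≤ ∞` [`0 ≤ d < 1`], then `u` is smooth in `(0, T] × ℝ³`" (axisymmetric `H²` data,
`ν = 1`).  Rendered as Thm. 1.1 (1) with `u³ = axialVelocity` for `u^θ`. [cite: ChenFangZhang2017, Thm. 1.4 (1)] -/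
def ChenFangZhang2017_weightedAxial_regularity : Prop :=
  ∀ (d : ℝ) (p q : ℝ≥0∞), 0 ≤ d → d < 1 →
    2 / p + 3 / q ≤ ENNReal.ofReal (1 - d) → ENNReal.ofReal (3 / (1 - d)) < q →
    ENNReal.ofReal (2 / (1 - d)) ≤ p →
    ∀ (T : ℝ) (u : ℝ → ℝ³ → ℝ³) (π : ℝ → ℝ³ → ℝ), 0 < T →
    IsClassicalNSSolutionOn (Ico 0 T) 1 0 u π → IsLerayHopfOn T 1 0 (u 0) u →
    HasRapidSpatialDecay (u 0) → (∀ t ∈ Ico 0 T, IsAxisymmetric (u t)) →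
    MemLqLp p q (weightedAxialVelocity d u) (Ioo 0 T) →
    HasSmoothExtensionPast 1 0 u T

/-- **Chen–Fang–Zhang 2017, Theorem 1.4 (2): the critical class for `r^d u³` with smallness near
the axis.**  "If `r^d u³ ∈ L^{∞,3/(1−d)}_T`, and there exist `β > 0` and sufficient small `ε₁ > 0`
such that `‖r^d u³ 1_{r ≤ β}‖_{L^{∞,3/(1−d)}_T} ≤ ε₁`, where `0 ≤ d < 1`, then `u` is smooth in
`(0, T] × ℝ³`" (threshold depending on `d` only).  Rendered as Thm. 1.1 (2) with `u³` for `u^θ`. [cite: ChenFangZhang2017, Thm. 1.4 (2)] -/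
def ChenFangZhang2017_criticalAxialSmallNearAxis_regularity : Prop :=
  ∀ d : ℝ, 0 ≤ d → d < 1 → ∃ ε : ℝ, 0 < ε ∧
    ∀ (T : ℝ) (u : ℝ → ℝ³ → ℝ³) (π : ℝ → ℝ³ → ℝ), 0 < T →
    IsClassicalNSSolutionOn (Ico 0 T) 1 0 u π → IsLerayHopfOn T 1 0 (u 0) u →
    HasRapidSpatialDecay (u 0) → (∀ t ∈ Ico 0 T, IsAxisymmetric (u t)) →
    MemLqLp ∞ (ENNReal.ofReal (3 / (1 - d))) (weightedAxialVelocity d u) (Ioo 0 T) →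
    (∃ β : ℝ, 0 < β ∧
      eLqLpNorm ∞ (ENNReal.ofReal (3 / (1 - d)))
        (fun t => {x : ℝ³ | cylRadius x ≤ β}.indicator (weightedAxialVelocity d u t)) (Ioo 0 T) ≤
        ENNReal.ofReal ε) →
    HasSmoothExtensionPast 1 0 u T

/-- **Chen–Fang–Zhang 2017, Corollary 1.5: `r u³ ∈ L^∞` implies regularity.**  "Let `u` be an
axisymmetric suitable weak solution […] with the axisymmetric initial data `u₀ ∈ L²(ℝ³)`,
`div u₀ = 0`, and `r u₀^θ ∈ L^∞(ℝ³)`. Suppose `r u³ ∈ L^{∞,∞}_T`, then `u` is smooth in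
`(0, T] × ℝ³`" (`ν = 1`; deduced in print from Lei–Zhang 2011 through the bounded angular stream
function; the all-time form is Lei–Navas–Zhang 2016, Appendix Prop. 2).  Rendered in the classical
continuation frame of the module docstring (a smaller class than print's, hence weaker), with
`r|u³(t, x)| ≤ C` pointwise on `[0, T) × ℝ³`. [cite: ChenFangZhang2017, Cor. 1.5] -/
def ChenFangZhang2017_boundedRAxial_regularity : Prop :=
  ∀ (C T : ℝ) (u : ℝ → ℝ³ → ℝ³) (π : ℝ → ℝ³ → ℝ), 0 < T →
    IsClassicalNSSolutionOn (Ico 0 T) 1 0 u π → IsLerayHopfOn T 1 0 (u 0) u →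
    HasRapidSpatialDecay (u 0) → (∀ t ∈ Ico 0 T, IsAxisymmetric (u t)) →
    eLpNorm (swirl (u 0)) ∞ volume < ∞ →
    (∀ t ∈ Ico 0 T, ∀ x : ℝ³, cylRadius x * |axialVelocity (u t) x| ≤ C) →
    HasSmoothExtensionPast 1 0 u T

/-- The endpoint pair `(p, q) = (∞, ∞)` satisfies the conditions of Thm. 1.1 (1) / 1.4 (1) for
every `d ≤ 1`: `2/∞ + 3/∞ = 0 ≤ 1 − d`, `3/(1−d) < ∞`, `2/(1−d) ≤ ∞`. [cite: ChenFangZhang2017, Thm. 1.1 (1)] -/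
theorem ChenFangZhang2017.exponents_top_top (d : ℝ) :
    (2 : ℝ≥0∞) / ⊤ + 3 / ⊤ ≤ ENNReal.ofReal (1 - d) ∧ ENNReal.ofReal (3 / (1 - d)) < ⊤ ∧
      ENNReal.ofReal (2 / (1 - d)) ≤ (⊤ : ℝ≥0∞) := by
  refine ⟨?_, ENNReal.ofReal_lt_top, le_top⟩
  rw [ENNReal.div_top, ENNReal.div_top, add_zero]
  exact zero_le

/-- At `d = 0` the conditions of Thm. 1.1 (1) are the Prodi–Serrin conditions `2/p + 3/q ≤ 1`,
`3 < q` (and `2 ≤ p`, which follows). [cite: ChenFangZhang2017, Remark 3] -/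
theorem ChenFangZhang2017.exponents_zero {p q : ℝ≥0∞} (hpq : 2 / p + 3 / q ≤ 1) (hq : 3 < q) :
    2 / p + 3 / q ≤ ENNReal.ofReal (1 - 0) ∧ ENNReal.ofReal (3 / (1 - 0)) < q ∧
      ENNReal.ofReal (2 / (1 - 0)) ≤ p := by
  simp only [sub_zero, div_one, ENNReal.ofReal_one]
  refine ⟨hpq, by simpa using hq, ?_⟩
  rw [show ENNReal.ofReal 2 = 2 by simp]
  have h2p : 2 / p ≤ 1 := le_trans le_self_add hpq
  have h := (ENNReal.div_le_iff_le_mul (Or.inr ENNReal.one_ne_top) (Or.inr one_ne_zero)).1 h2p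
  simpa using h

/-! ### Proved corollaries: Remarks 2 and 3 -/

/-- A pointwise Hölder modulus of the swirl, `|Γ(t,x)| ≤ C r^α` (`Γ = swirl = r u^θ`,
`0 < α ≤ 1`), puts `r^{1−α} u^θ` in `L^∞(0,T; L^∞(ℝ³))` with norm `≤ C`
(`r^{1−α}|u^θ| = r^{−α}|Γ| ≤ C` off the axis, `= 0` on it). [cite: ChenFangZhang2017, Remark 2] -/
theorem ChenFangZhang2017.memLqLp_top_top_weightedSwirlVelocity_of_holderSwirl {α C T : ℝ}
    {u : ℝ → ℝ³ → ℝ³} (hC : 0 ≤ C) (hcont : ∀ t ∈ Ico 0 T, Continuous (u t))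
    (hmod : ∀ t ∈ Ico 0 T, ∀ x : ℝ³, |swirl (u t) x| ≤ C * cylRadius x ^ α) :
    MemLqLp ∞ ∞ (weightedSwirlVelocity (1 - α) u) (Ioo 0 T) := by
  have hpt : ∀ t ∈ Ico 0 T, ∀ x : ℝ³, ‖weightedSwirlVelocity (1 - α) u t x‖ ≤ C := by
    intro t ht x
    rw [Real.norm_eq_abs]
    by_cases hx : cylRadius x = 0
    · rw [weightedSwirlVelocity_eq_zero_of_cylRadius_eq_zero u t hx, abs_zero]; exact hC
    · have hr : 0 < cylRadius x := lt_of_le_of_ne (cylRadius_nonneg x) (Ne.symm hx)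
      rw [weightedSwirlVelocity_eq_rpow_mul_swirl u t hx, abs_mul,
        abs_of_nonneg (Real.rpow_nonneg hr.le _), show (1 - α - 1 : ℝ) = -α by ring,
        Real.rpow_neg hr.le]
      have hpos : 0 < cylRadius x ^ α := Real.rpow_pos_of_pos hr α
      calc (cylRadius x ^ α)⁻¹ * |swirl (u t) x| ≤ (cylRadius x ^ α)⁻¹ * (C * cylRadius x ^ α) := by
            gcongr; exact hmod t ht x
        _ = C := by field_simp
  have hslice : ∀ t ∈ Ioo 0 T, MemLp (weightedSwirlVelocity (1 - α) u t) ∞ volume ∧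
      eLpNorm (weightedSwirlVelocity (1 - α) u t) ∞ volume ≤ ENNReal.ofReal C := by
    intro t ht
    have ht' : t ∈ Ico 0 T := Ioo_subset_Ico_self ht
    have hmeas : AEStronglyMeasurable (weightedSwirlVelocity (1 - α) u t) volume :=
      (measurable_weightedSwirlVelocity (1 - α) (hcont t ht')).aestronglyMeasurable
    have hb : ∀ᵐ x ∂(volume : Measure ℝ³), ‖weightedSwirlVelocity (1 - α) u t x‖ ≤ C :=
      Eventually.of_forall (hpt t ht')
    refine ⟨memLp_top_of_bound hmeas C hb, ?_⟩
    rw [eLpNorm_exponent_top]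
    exact eLpNormEssSup_le_of_ae_bound hb
  refine memLqLp_of_ae_eLpNorm_le (C := ENNReal.ofReal C) ENNReal.ofReal_ne_top ?_ ?_ ?_
  · rw [Real.volume_Ioo]; exact ENNReal.ofReal_ne_top
  · exact (ae_restrict_iff' measurableSet_Ioo).2 (Eventually.of_forall fun t ht => (hslice t ht).1)
  · exact (ae_restrict_iff' measurableSet_Ioo).2 (Eventually.of_forall fun t ht => (hslice t ht).2)

/-- **Chen–Fang–Zhang 2017, Remark 2 (Hölder swirl criterion), from Theorem 1.1 (1).**  "If
`r u^θ` is Hölder continuous at the variable `r` uniformly, i.e. there exist `α > 0` and constant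
`C` such that `r|u^θ| ≤ C r^α` a.e. `(t,x) ∈ (0,T) × ℝ³`, then `u` is regular": in the rendering
of the fact, a classical Leray–Hopf solution on `[0, T)` from a rapidly decaying datum with
axisymmetric slices and `|Γ(t, x)| ≤ C (cylRadius x)^α` on `[0,T) × ℝ³` for some `0 < α ≤ 1`,
`C ≥ 0`, extends smoothly past `T` — the case `(d, p, q) = (1 − α, ∞, ∞)` of Thm. 1.1 (1) (for
`α > 1` the modulus forces `u^θ ≡ 0` near the axis only asymptotically and is not an instance of
the printed exponent range `0 ≤ d`; print's "a.e." is strengthened to "everywhere", harmless for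
continuous slices). Conditional on the fact. [cite: ChenFangZhang2017, Remark 2] -/
theorem ChenFangZhang2017_weightedSwirl_regularity.of_holderSwirl
    (h : ChenFangZhang2017_weightedSwirl_regularity) {α C T : ℝ} (hα : 0 < α) (hα1 : α ≤ 1)
    (hC : 0 ≤ C) {u : ℝ → ℝ³ → ℝ³} {π : ℝ → ℝ³ → ℝ} (hT : 0 < T)
    (hns : IsClassicalNSSolutionOn (Ico 0 T) 1 0 u π) (hlh : IsLerayHopfOn T 1 0 (u 0) u)
    (hdec : HasRapidSpatialDecay (u 0)) (hax : ∀ t ∈ Ico 0 T, IsAxisymmetric (u t))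
    (hmod : ∀ t ∈ Ico 0 T, ∀ x : ℝ³, |swirl (u t) x| ≤ C * cylRadius x ^ α) :
    HasSmoothExtensionPast 1 0 u T := by
  obtain ⟨h1, h2, h3⟩ := ChenFangZhang2017.exponents_top_top (1 - α)
  refine h (1 - α) ⊤ ⊤ (by linarith) (by linarith) h1 h2 h3 T u π hT hns hlh hdec hax ?_
  exact ChenFangZhang2017.memLqLp_top_top_weightedSwirlVelocity_of_holderSwirl hC
    (fun t ht => (hns.contDiff_velocity ht).continuous) hmod

/-- **Chen–Fang–Zhang 2017, Remark 3 (Prodi–Serrin condition on `u^θ`), from Theorem 1.1 (1).**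
"If the angular velocity `u^θ` satisfies the Prodi–Serrin condition `u^θ ∈ L^p((0,T); L^q(ℝ³))`,
`2/p + 3/q ≤ 1`, `3 < q ≤ ∞`, then the solution `u` is smooth in `(0, T] × ℝ³`": the case `d = 0`
of Thm. 1.1 (1), in the rendering of the fact. Conditional on the fact. [cite: ChenFangZhang2017, Remark 3] -/
theorem ChenFangZhang2017_weightedSwirl_regularity.of_prodiSerrin_swirlVelocity
    (h : ChenFangZhang2017_weightedSwirl_regularity) {p q : ℝ≥0∞} (hpq : 2 / p + 3 / q ≤ 1)
    (hq : 3 < q) {T : ℝ} {u : ℝ → ℝ³ → ℝ³} {π : ℝ → ℝ³ → ℝ} (hT : 0 < T)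
    (hns : IsClassicalNSSolutionOn (Ico 0 T) 1 0 u π) (hlh : IsLerayHopfOn T 1 0 (u 0) u)
    (hdec : HasRapidSpatialDecay (u 0)) (hax : ∀ t ∈ Ico 0 T, IsAxisymmetric (u t))
    (hS : MemLqLp p q (fun t x => swirlVelocity (u t) x) (Ioo 0 T)) :
    HasSmoothExtensionPast 1 0 u T := by
  obtain ⟨h1, h2, h3⟩ := ChenFangZhang2017.exponents_zero hpq hq
  refine h 0 p q le_rfl zero_lt_one h1 h2 h3 T u π hT hns hlh hdec hax ?_
  rwa [weightedSwirlVelocity_zero]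

/-- **Thm. 1.4 (1) at `d = 0`: the Prodi–Serrin condition on the single component `u³`** of an
axisymmetric classical Leray–Hopf solution (`u³ ∈ L^p(0,T;L^q)`, `2/p + 3/q ≤ 1`, `3 < q ≤ ∞`)
forces a smooth extension past `T` — the axisymmetric companion of the symmetry-free
one-component criterion `chaeWolf2021_oneComponent_almostSerrin_criterion` (which needs the STRICT
inequality). Conditional on the fact. [cite: ChenFangZhang2017, Thm. 1.4 (1)] -/
theorem ChenFangZhang2017_weightedAxial_regularity.of_prodiSerrin_axialVelocity
    (h : ChenFangZhang2017_weightedAxial_regularity) {p q : ℝ≥0∞} (hpq : 2 / p + 3 / q ≤ 1)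
    (hq : 3 < q) {T : ℝ} {u : ℝ → ℝ³ → ℝ³} {π : ℝ → ℝ³ → ℝ} (hT : 0 < T)
    (hns : IsClassicalNSSolutionOn (Ico 0 T) 1 0 u π) (hlh : IsLerayHopfOn T 1 0 (u 0) u)
    (hdec : HasRapidSpatialDecay (u 0)) (hax : ∀ t ∈ Ico 0 T, IsAxisymmetric (u t))
    (hS : MemLqLp p q (fun t x => axialVelocity (u t) x) (Ioo 0 T)) :
    HasSmoothExtensionPast 1 0 u T := by
  obtain ⟨h1, h2, h3⟩ := ChenFangZhang2017.exponents_zero hpq hq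
  refine h 0 p q le_rfl zero_lt_one h1 h2 h3 T u π hT hns hlh hdec hax ?_
  rwa [weightedAxialVelocity_zero]

end Literature.Analysis.FluidPDE

end
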